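import Mathlib
import Literature.Computability.AlgebraicComplexity.StandardFamiliesProofs
import Literature.Computability.AlgebraicComplexity.DeterminantalConormalBoundKernelAlgebra
import Summits.ValiantsHypothesis.ValiantsHypothesis.Theorems.ChowBorderDepth3ChowBorderBoundDefs
import Summits.ValiantsHypothesis.ValiantsHypothesis.Theorems.ChowBorderDepth3ChowBorderBoundQuotDerivCalc
import Summits.ValiantsHypothesis.ValiantsHypothesis.Theorems.ChowBorderDepth3ChowBorderBoundEpsSpan
import Summits.ValiantsHypothesis.ValiantsHypothesis.Theorems.ChowBorderDepth3ChowBorderBoundResidueTransfer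
import Summits.ValiantsHypothesis.ValiantsHypothesis.Theorems.ChowBorderDepth3ChowBorderBoundInitialFormTransfer
import Summits.ValiantsHypothesis.ValiantsHypothesis.Theorems.ChowBorderDepth3ChowBorderBoundDegenerationDatum
import Summits.ValiantsHypothesis.ValiantsHypothesis.Theorems.ChowBorderDepth3ChowBorderBoundMonomialLowerBound
import Summits.ValiantsHypothesis.ValiantsHypothesis.Theorems.ChowBorderDepth3ChowBorderBoundBorderFanInOne
import Summits.ValiantsHypothesis.ValiantsHypothesis.Theorems.ChowBorderDepth3ChowBorderBoundNegativeDBound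
import Summits.ValiantsHypothesis.ValiantsHypothesis.Theorems.ChowBorderDepth3ChowBorderBoundFanInRungs

/-!
# Fan-in two for `ChowBorderDepth3.ChowBorderBound`: the upper and lower bounds (exact DiDIL)

Sub-goals of crux `stmt-ValiantsHypothesis-5936`
(`Summit.ValiantsHypothesis.ValiantsHypothesis.Theses.ChowBorderDepth3.ChowBorderBound`), line
`registered`, lead c2 — part 1 of the assembly of wave 2 (part 2, the case analysis and the rung
`C(⌊n/4⌋, ⌊n/8⌋) ≤ 4D`, is `ChowBorderDepth3ChowBorderBoundFanInTwo.lean`).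

* `card_le_of_cancelling` — UPPER BOUND: in the cancelling case `T₀ + T₁ = ε^(w+1) B` of a
  two-summand border expression (`T_i` products of `D` ε-affine forms, `red B = per_n`,
  `red T₀ = −red T₁ ≠ 0`), every ℂ-independent family of quotient-derivative numerators
  `qdn per_n t₁ u` (`t₁ = red T₁`, `|u| = t`) has at most `4D` members (`EpsSpan` +
  `QuotDerivCalc` + `ResidueTransfer`);
* `exists_independent_of_affine_prod` / `fanInTwo_lowerBound` — LOWER BOUND: for every non-zero
  product `t₁` of affine forms over `ℂ` and `1 ≤ s ≤ n/4` there are `C(⌊n/4⌋, s)` independent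
  ones (`DegenerationDatum` + `MonomialLowerBound` + `InitialFormTransfer`);
* `red_eq_perPoly_of_lt`, `prod_ne_perPoly`, `prod_add_prod_ne_perPoly` — the classical cases.

References: P. Dutta, P. Dwivedi, N. Saxena, FOCS 2021 / SIAM J. Comput. (DiDIL);
M. Kumar, ACM ToCT 12 (2020), doi:10.1145/3371506; J. M. Landsberg (2017) Cor. 7.5.3.3.
-/

-- `Summit.ValiantsHypothesis.ValiantsHypothesis.…` is the tree's mandated single-conjunct layout
-- (Sub = Summit), so the duplicated namespace component is intended.
set_option linter.dupNamespace false

namespace Summit.ValiantsHypothesis.ValiantsHypothesis.Theorems.ChowBorderBound.FanInTwo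

open MvPolynomial
open Literature.Computability.AlgebraicComplexity
open Summit.ValiantsHypothesis.ValiantsHypothesis.Theorems.ChowBorderBound.QuotDeriv
open scoped Polynomial

variable {n : ℕ}

/-! ## §1 The two reductions agree: `red ∘ Φ = map constantCoeff` -/

/-- The structure map `Φ : ℂ[ε][x] → ℂ[x, ε]` (coefficients `ℂ[ε]` become the variable `X none`)
sends `C a` to `a(ε)`. [folklore] -/
theorem aevalTower_C' (a : ℂ[X]) :
    MvPolynomial.aevalTower (Polynomial.aeval (MvPolynomial.X (none : Option (Fin n × Fin n))))
        (fun v : Fin n × Fin n => (MvPolynomial.X (some v) : MvPolynomial (Option (Fin n × Fin n)) ℂ))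
        (C a) =
      Polynomial.aeval (MvPolynomial.X (none : Option (Fin n × Fin n))) a :=
  aevalTower_C _ _ _

/-- Reduction `ε ↦ 0` after `Φ` is reduction of the coefficients modulo `ε`. [folklore] -/
theorem red_aevalTower (p : MvPolynomial (Fin n × Fin n) ℂ[X]) :
    MvPolynomial.aeval (fun o : Option (Fin n × Fin n) => o.elim (0 : MvPolynomial (Fin n × Fin n) ℂ) X)
        (MvPolynomial.aevalTower (Polynomial.aeval (MvPolynomial.X (none : Option (Fin n × Fin n))))
          (fun v : Fin n × Fin n =>
            (MvPolynomial.X (some v) : MvPolynomial (Option (Fin n × Fin n)) ℂ)) p) =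
      MvPolynomial.map Polynomial.constantCoeff p := by
  induction p using MvPolynomial.induction_on with
  | C a =>
    rw [aevalTower_C', map_C, ← Polynomial.aeval_algHom_apply, aeval_X]
    change Polynomial.aeval (0 : MvPolynomial (Fin n × Fin n) ℂ) a = _
    rw [← Polynomial.coeff_zero_eq_aeval_zero', MvPolynomial.algebraMap_eq,
      Polynomial.constantCoeff_apply]
  | add p q hp hq => simp only [map_add, hp, hq]
  | mul_X p v hp => simp only [map_mul, hp, aevalTower_X, aeval_X, Option.elim_some, map_X]

/-- An affine `ℓ'` over `ℂ[ε]` becomes an ε-affine form `ι a₀ + Σ_v ι(a v) X(some v)` under `Φ`.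
[folklore] -/
theorem aevalTower_affine {p : MvPolynomial (Fin n × Fin n) ℂ[X]} (hp : p.totalDegree ≤ 1) :
    ∃ (a₀ : ℂ[X]) (a : Fin n × Fin n → ℂ[X]),
      MvPolynomial.aevalTower (Polynomial.aeval (MvPolynomial.X (none : Option (Fin n × Fin n))))
          (fun v : Fin n × Fin n =>
            (MvPolynomial.X (some v) : MvPolynomial (Option (Fin n × Fin n)) ℂ)) p =
        Polynomial.aeval (MvPolynomial.X (none : Option (Fin n × Fin n)) :
            MvPolynomial (Option (Fin n × Fin n)) ℂ) a₀ +
          ∑ v : Fin n × Fin n, Polynomial.aeval (MvPolynomial.X (none : Option (Fin n × Fin n)) :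
            MvPolynomial (Option (Fin n × Fin n)) ℂ) (a v) * MvPolynomial.X (some v) := by
  refine ⟨coeff 0 p, fun v => coeff (Finsupp.single v 1) p, ?_⟩
  conv_lhs => rw [DeterminantalConormal.eq_C_add_sum_of_totalDegree_le_one hp]
  simp only [map_add, map_sum, map_mul, aevalTower_C', aevalTower_X]


/-! ## §2 Upper bound: in the cancelling case every independent family has at most `4D` members -/

/-- **Upper bound (exact DiDIL at fan-in two).**  In the cancelling situation
`T₀ + T₁ = ε^(w+1) B` (`T_i = Π_j λ_ij` products of ε-affine forms, `red B = per_n`,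
`red T₀ = −red T₁ ≠ 0`), every ℂ-linearly independent family of quotient-derivative numerators
`qdn per_n t₁ u` (`t₁ = red T₁`, words `u` of a fixed length `t`) has at most `4D` members:
by `EpsSpan` each `ε^w · qdn P₁ Λ u` lies in the `ℂ[ε]`-module generated by the `4D` polynomials
`∂_ελ_ij · Λ_îĵ^(t+1)`, `λ_ij · Λ_îĵ^(t+1)`, by `QuotDerivCalc` its reduction is
`(w+1)(−1)^t t₁^(t+1) · qdn per_n t₁ u`, and `ResidueTransfer` makes `4D + 1` of them dependent.
[cite: DuttaDwivediSaxena2022, §3 (DiDIL)] -/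
theorem card_le_of_cancelling {D w : ℕ}
    (lam : Fin 2 → Fin D → MvPolynomial (Option (Fin n × Fin n)) ℂ)
    (B : MvPolynomial (Option (Fin n × Fin n)) ℂ)
    (hlam : ∀ i j, ∃ (a₀ : ℂ[X]) (a : Fin n × Fin n → ℂ[X]),
      lam i j = Polynomial.aeval (MvPolynomial.X (none : Option (Fin n × Fin n)) :
          MvPolynomial (Option (Fin n × Fin n)) ℂ) a₀ +
        ∑ v : Fin n × Fin n, Polynomial.aeval (MvPolynomial.X (none : Option (Fin n × Fin n)) :
          MvPolynomial (Option (Fin n × Fin n)) ℂ) (a v) * MvPolynomial.X (some v))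
    (hcore : (∏ j, lam 0 j) + (∏ j, lam 1 j) =
      (MvPolynomial.X (none : Option (Fin n × Fin n)) : MvPolynomial (Option (Fin n × Fin n)) ℂ) ^
        (w + 1) * B)
    (hB : MvPolynomial.aeval (fun o : Option (Fin n × Fin n) =>
        o.elim (0 : MvPolynomial (Fin n × Fin n) ℂ) X) B = perPoly (Fin n) ℂ)
    (ht : MvPolynomial.aeval (fun o : Option (Fin n × Fin n) =>
        o.elim (0 : MvPolynomial (Fin n × Fin n) ℂ) X) (∏ j, lam 0 j) =
      - MvPolynomial.aeval (fun o : Option (Fin n × Fin n) =>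
        o.elim (0 : MvPolynomial (Fin n × Fin n) ℂ) X) (∏ j, lam 1 j))
    (ht1 : MvPolynomial.aeval (fun o : Option (Fin n × Fin n) =>
        o.elim (0 : MvPolynomial (Fin n × Fin n) ℂ) X) (∏ j, lam 1 j) ≠ 0)
    (t : ℕ) (Γ : Finset (Fin t → Fin n × Fin n))
    (hli : LinearIndependent ℂ (fun u : Γ =>
      quotDerivNum (perPoly (Fin n) ℂ)
        (MvPolynomial.aeval (fun o : Option (Fin n × Fin n) =>
          o.elim (0 : MvPolynomial (Fin n × Fin n) ℂ) X) (∏ j, lam 1 j))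
        (List.ofFn fun k => u.1 k))) :
    Γ.card ≤ 4 * D := by
  classical
  -- notation
  set ε : MvPolynomial (Option (Fin n × Fin n)) ℂ := MvPolynomial.X none with hε
  set red := MvPolynomial.aeval (R := ℂ)
    (fun o : Option (Fin n × Fin n) => o.elim (0 : MvPolynomial (Fin n × Fin n) ℂ) X) with hred
  set T₁ : MvPolynomial (Option (Fin n × Fin n)) ℂ := ∏ j, lam 1 j with hT₁
  set t₁ : MvPolynomial (Fin n × Fin n) ℂ := red T₁ with ht₁
  set P₁ : MvPolynomial (Option (Fin n × Fin n)) ℂ :=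
    (w + 1) • (B * T₁) + ε * (pderiv none B * T₁ - B * pderiv none T₁) with hP₁
  set Λ : MvPolynomial (Option (Fin n × Fin n)) ℂ := (∏ j, lam 0 j) * T₁ with hΛ
  refine le_of_not_gt fun hlt => ?_
  -- the `4D` generators and the family
  let G : Fin 2 × Fin D × Bool → MvPolynomial (Option (Fin n × Fin n)) ℂ := fun l =>
    (bif l.2.2 then pderiv none (lam l.1 l.2.1) else lam l.1 l.2.1) *
      (∏ p ∈ Finset.univ.erase (l.1, l.2.1), lam p.1 p.2) ^ (t + 1)
  let Y : Γ → MvPolynomial (Option (Fin n × Fin n)) ℂ := fun u =>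
    quotDerivNum P₁ Λ (List.ofFn fun k => some (u.1 k))
  have hcard : Fintype.card (Fin 2 × Fin D × Bool) < Fintype.card Γ := by
    simp only [Fintype.card_prod, Fintype.card_fin, Fintype.card_bool, Fintype.card_coe]
    omega
  have hY : ∀ u : Γ, ∃ c : Fin 2 × Fin D × Bool → ℂ[X],
      ε ^ w * Y u = ∑ l, Polynomial.aeval ε (c l) * G l := by
    intro u
    obtain ⟨c, d, hcd⟩ := EpsSpan.stub_epsSpan n D w lam B hlam hcore t u.1
    refine ⟨fun l => bif l.2.2 then c l.1 l.2.1 else d l.1 l.2.1, ?_⟩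
    rw [hcd]
    simp only [Fintype.sum_prod_type, Fintype.sum_bool, Bool.cond_true, Bool.cond_false, G]
    refine Finset.sum_congr rfl fun i _ => Finset.sum_congr rfl fun j _ => ?_
    ring
  have hdep := ResidueTransfer.stub_residueTransfer n w (Fin 2 × Fin D × Bool) Γ G Y hcard hY
  apply hdep
  -- the reductions are a common non-zero multiple of `qdn per t₁ u`
  have hredε : red ε = 0 := by rw [hred, hε, aeval_X]; rfl
  have hredP₁ : red P₁ = C ((w : ℂ) + 1) * (perPoly (Fin n) ℂ * t₁) := by
    rw [hP₁, map_add, map_mul, hredε, zero_mul, add_zero, map_nsmul, map_mul, hB, ← ht₁,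
      nsmul_eq_mul, Nat.cast_add, Nat.cast_one, map_add, map_natCast, map_one]
  have hredΛ : red Λ = (-1 * t₁) * t₁ := by
    rw [hΛ, map_mul, ht, ← ht₁]; ring
  have hK : C ((w : ℂ) + 1) * (t₁ ^ (t + 1) * (-1) ^ t) ≠ 0 := by
    refine mul_ne_zero (C_ne_zero.2 ?_) (mul_ne_zero (pow_ne_zero _ ?_) (pow_ne_zero _ ?_))
    · exact Nat.cast_add_one_ne_zero w
    · rw [ht₁]; exact ht1
    · exact neg_ne_zero.2 one_ne_zero
  have hredY : ∀ u : Γ, red (Y u) =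
      C ((w : ℂ) + 1) * (t₁ ^ (t + 1) * (-1) ^ t) *
        quotDerivNum (perPoly (Fin n) ℂ) t₁ (List.ofFn fun k => u.1 k) := by
    intro u
    have hmap : (List.ofFn fun k => some (u.1 k)) = (List.ofFn fun k => u.1 k).map some := by
      rw [List.map_ofFn]; rfl
    change red (quotDerivNum P₁ Λ (List.ofFn fun k => some (u.1 k))) = _
    rw [hmap, QuotDerivCalc.aeval_optionElim_quotDerivNum, ← hred, hredP₁, hredΛ,
      quotDerivNum_C_mul, QuotDerivCalc.quotDerivNum_mul_mul,
      QuotDerivCalc.quotDerivNum_mul_denom (-1) _ _ _ (fun v _ => by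
        rw [map_neg, Derivation.map_one_eq_zero, neg_zero]),
      List.length_ofFn]
    ring
  have hfun : (fun u : Γ => red (Y u)) =
      (LinearMap.mulLeft ℂ (C ((w : ℂ) + 1) * (t₁ ^ (t + 1) * (-1) ^ t))) ∘
        (fun u : Γ => quotDerivNum (perPoly (Fin n) ℂ) t₁ (List.ofFn fun k => u.1 k)) := by
    funext u
    rw [hredY u, Function.comp_apply, LinearMap.mulLeft_apply]
  rw [hfun]
  exact hli.map' _ (LinearMap.ker_eq_bot_of_injective (mul_right_injective₀ hK))

/-! ## §3 Lower bound: torus degeneration to a monomial denominator -/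

/-- **Lower bound.**  For a non-zero product `t₁ = Π_j λ̄_j` of affine forms over `ℂ` and
`n ≥ 8` there are at least `C(⌊n/4⌋, ⌊n/8⌋)` ℂ-independent quotient-derivative numerators
`qdn per_n t₁ u` with `|u| = ⌊n/8⌋`: degenerate `t₁` along the torus `x_ij ↦ τ^(n i + j + 1) x_ij`
(`DegenerationDatum`), count at the monomial (`MonomialLowerBound`), transfer back
(`InitialFormTransfer`). [folklore] -/
theorem exists_independent_of_affine_prod {s : ℕ} (hs : 1 ≤ s) (hsn : 4 * s ≤ n) {D : ℕ}
    (lamC : Fin D → MvPolynomial (Fin n × Fin n) ℂ)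
    (hdeg : ∀ j, (lamC j).totalDegree ≤ 1) (hne : ∀ j, lamC j ≠ 0) :
    ∃ Γ : Finset (Fin s → Fin n × Fin n), (n / 4).choose s ≤ Γ.card ∧
      LinearIndependent ℂ (fun u : Γ =>
        quotDerivNum (perPoly (Fin n) ℂ) (∏ j, lamC j) (List.ofFn fun k => u.1 k)) := by
  obtain ⟨hper, hdat⟩ := DegenerationDatum.stub_degenerationDatum
  obtain ⟨M, β, κ, Q, hκ, hθ⟩ := hdat n D lamC hdeg hne
  obtain ⟨Γ, hcard, hliM⟩ := MonomialLowerBound.stub_monomialLowerBound n β κ hκ s hs hsn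
  refine ⟨Γ, hcard, ?_⟩
  exact InitialFormTransfer.stub_initialFormTransfer QuotDerivCalc.stub_quotDerivCalc n
    (fun v : Fin n × Fin n => n * (v.1 : ℕ) + (v.2 : ℕ) + 1) (perPoly (Fin n) ℂ) (∏ j, lamC j)
    (C κ * monomial β 1) _ M Q (hper n) hθ s Γ hliM


/-! ## §4 The crux at top fan-in two: `C(⌊n/4⌋, ⌊n/8⌋) ≤ 4D` -/

/-- **Different blow-up orders are classical.**  If `ε^a U + ε^b V = ε^q B` in `ℂ[ε][x]` with
`a < b`, `U` non-zero modulo `ε` and `B ≡ per_n (mod ε)`, then `per_n = red U`: the smaller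
power is `ε^q`, and reducing modulo `ε` kills the other gate. [folklore] -/
theorem red_eq_perPoly_of_lt {a b q : ℕ} {U V B : MvPolynomial (Fin n × Fin n) ℂ[X]}
    (h : C (Polynomial.X ^ a) * U + C (Polynomial.X ^ b) * V = C (Polynomial.X ^ q) * B)
    (hab : a < b) (hU : MvPolynomial.map Polynomial.constantCoeff U ≠ 0)
    (hB : MvPolynomial.map Polynomial.constantCoeff B = perPoly (Fin n) ℂ) :
    MvPolynomial.map Polynomial.constantCoeff U = perPoly (Fin n) ℂ := by
  -- `ε^a (U + ε^(b-a) V) = ε^q B`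
  set W : MvPolynomial (Fin n × Fin n) ℂ[X] := U + C (Polynomial.X ^ (b - a)) * V with hW
  have hW' : C (Polynomial.X ^ a) * W = C (Polynomial.X ^ q) * B := by
    rw [← h, hW, mul_add, ← mul_assoc, ← map_mul, ← pow_add, Nat.add_sub_cancel' hab.le]
  have hredW : MvPolynomial.map Polynomial.constantCoeff W =
      MvPolynomial.map Polynomial.constantCoeff U := by
    rw [hW, map_add, map_mul, BorderFanInOne.map_constantCoeff_C_X_pow (Nat.sub_pos_of_lt hab),
      zero_mul, add_zero]
  rcases lt_trichotomy a q with haq | rfl | hqa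
  · exact absurd (hredW ▸ BorderFanInOne.map_constantCoeff_eq_zero_of_lt haq hW') hU
  · have hCa : (C (Polynomial.X ^ a) : MvPolynomial (Fin n × Fin n) ℂ[X]) ≠ 0 :=
      C_ne_zero.2 (pow_ne_zero _ Polynomial.X_ne_zero)
    rw [← hredW, mul_left_cancel₀ hCa hW', hB]
  · exact absurd (hB ▸ BorderFanInOne.map_constantCoeff_eq_zero_of_lt hqa hW'.symm)
      (perPoly_ne_zero (Fin n) ℂ)


/-- `per_n` is not a product of `D` affine forms over `ℂ` (`FanInRungs.perPoly_ne_sps_of_lt` at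
`r = 1`). [folklore] -/
theorem prod_ne_perPoly (h1n : 1 < n) {D : ℕ} (m : Fin D → MvPolynomial (Fin n × Fin n) ℂ)
    (hdeg : ∀ j, (m j).totalDegree ≤ 1) : ∏ j, m j ≠ perPoly (Fin n) ℂ := by
  have key := FanInRungs.perPoly_ne_sps_of_lt n 1 D h1n (fun _ => m) (fun _ j => hdeg j)
  rwa [Fin.sum_univ_one] at key

/-- `per_n` is not a sum of two products of `D` affine forms over `ℂ`
(`FanInRungs.perPoly_ne_sps_of_lt` at `r = 2`). [folklore] -/
theorem prod_add_prod_ne_perPoly (h2n : 2 < n) {D : ℕ}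
    (m : Fin 2 → Fin D → MvPolynomial (Fin n × Fin n) ℂ) (hdeg : ∀ i j, (m i j).totalDegree ≤ 1) :
    (∏ j, m 0 j) + (∏ j, m 1 j) ≠ perPoly (Fin n) ℂ := by
  have key := FanInRungs.perPoly_ne_sps_of_lt n 2 D h2n m hdeg
  rwa [Fin.sum_univ_two] at key

/-- **Lower bound (registered form).**  For `1 ≤ s`, `4s ≤ n` and every non-zero product
of `D` affine forms `m_j` over `ℂ`, at least `C(⌊n/4⌋, s)` quotient-derivative numerators
`qdn per_n (Π_j m_j) u` with `|u| = s` are ℂ-linearly independent. [folklore] -/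
theorem fanInTwo_lowerBound :
    ∀ (n s : ℕ), 1 ≤ s → 4 * s ≤ n → ∀ (D : ℕ) (m : Fin D → MvPolynomial (Fin n × Fin n) ℂ),
      (∀ j, (m j).totalDegree ≤ 1) → (∀ j, m j ≠ 0) →
      ∃ Γ : Finset (Fin s → Fin n × Fin n), (n / 4).choose s ≤ Γ.card ∧
        LinearIndependent ℂ (fun u : Γ =>
          Summit.ValiantsHypothesis.ValiantsHypothesis.Theorems.ChowBorderBound.QuotDeriv.quotDerivNum
            (Literature.Computability.AlgebraicComplexity.perPoly (Fin n) ℂ) (∏ j, m j)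
            (List.ofFn fun k => u.1 k)) :=
  fun _ _ hs hsn _ m hdeg hne => exists_independent_of_affine_prod hs hsn m hdeg hne

end Summit.ValiantsHypothesis.ValiantsHypothesis.Theorems.ChowBorderBound.FanInTwo
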